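/-
Copyright (c) 2026 the pub-hodgecm-mathlib formalisation cell (harness21).  Prover seat hodgecm-mathlib-LH4-p09 (g6): Track A «(D-RAM) FOUR-FRAME» squad of crux H413, unit U2H (ii-H),
leaf (ρ2b′-X) — socket (C) (type RamM) organ (C-6) «H-SIDE-RM» ((C) lead LH4-p04 (g5) 2026-09-04T06:39Z), FILE 2∕2: THE HEAD, 2026-09-04.
-/
import Summits.HodgeConjecture.HodgeConjecture.Theorems.F0P3cDyRamFourthFieldLetters                      -- FILE 1 (this seat): trace token, root sizes, `ρ r₀ = −r₀`, the fourth-field Klein letter, `exists_kUniformizer`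
import Summits.HodgeConjecture.HodgeConjecture.Theorems.F0P3cDyRamHSideClosedForm                          -- ★ p857701 (LH4-p09 (g5)): `hSide_closedForm_of_tube_exists`; brings ★ (C2-i) p857582, ★ (C2-iii) LevelLetter, ★ (C2-ii) torus datum
import Summits.HodgeConjecture.HodgeConjecture.Theorems.F0P3cDyRamHSideDescentRatio                        -- ★ p857834 (LH4-p09 (g5)): `ratioWitness_sq_eq`, `map_map_ratioWitness_eq`, `discTraceSqDivDetSq_eq_map_of_descent`, `disc_mul_sq_eq`, `lam_mul_map_lam`
import Summits.HodgeConjecture.HodgeConjecture.Theorems.F0P3cDyRamUnramifiedQuadraticCompletionDictionary   -- ★ p857937∕p857979 (LH4-p10 (g3)): type-C dictionary `valued_toPlace_eq_sq_of_v_sub_galAdicCompletionMap_lt_one`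
import Summits.HodgeConjecture.HodgeConjecture.Theorems.F0P3cDyRamKleinDifferentLetters                    -- ★ p858036 (F0P3a-p01 (g34)): `v_sub_map_eq_of_uniformizer` (uniformiser-independence of `d`); brings ★ WildQuadraticDatum coordinates
import HarnessLib

/-!
# F0 · P3c · line LH4 «(D-RAM) FOUR-FRAME» — unit (ii-H), leaf (ρ2b′-X), socket (C), organ (C-6) FILE 2: THE H-SIDE CLOSED FORM IN TYPE RamM —
# `(q_w − 1)·(#Fix_{γ₂}(U₂ ⧸ K₂) + d % 2) + 2 = 2·q_w^{n+1}` WITH `4n + d_Θ = 2·jl` (so `2·n_H = jl − g`, `g = d_Θ∕2`: the H-LEVEL BINDER of ★ `toricCensusSum_ramM`)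
# (Kottwitz 1988 §2; Labesse–Langlands 1979 §2; Rogawski 1990 §4.9; Serre, *Local Fields* III §4–5, IV §1, XIV §4)

Cell `pub/hodgecm-mathlib` (D-0151), crux H413 = `stmt-HodgeConjecture-24833` (helper lane `--supports stmt-HodgeConjecture-24833 --as helper`, count-neutral); THEOREMS ONLY (no
definition, no instance, no notation, no named fact, no `sorry`, default heartbeats).  Tree socket served: (ρ2b′-X) `stub_U2H_fixedPointCensus_typeTwo_unit0` (U2H ED. 15 :418)
through the payer lineage's typed bottom socket (C) `SOCKET-hOCC.v1` (869d0c15, type RamM), (C) lead LH4-p04 (g5)'s architecture 2026-09-04T06:39Z: organ **(C-6) H-SIDE-RM**, the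
H-side of the socket's conclusion `(q−1)·(OC_h − OC_{h′}) = (β,θ)_v·q^m·((q−1)(#Fix + d%2) − 2(q^S − 1))` against the weld ★ p857711 `toricCensusSum_ramM`'s right-hand side
`q^m·(2[n_H+1]_q − 2[S]_q)`, `2·n_H = jl − g`, `g = d_Θ∕2` — i.e. `(q−1)(#Fix + d%2) + 2 = 2·q^{n_H+1}`.

WHAT IS PROVED — `hSide_closedForm_ramM`, ONE CALL for the (C) head.  Letters: ★ p857701's place binders (`L v w hw hϖF he hD γ₂ hirr htube`; the matrix of `γ₂` at `w` in the
`localNonsplitEquiv` spelling, `= γ₂.1.val.map (Pi.evalRingHom _ w)` by `rfl`, ★ `coe_localNonsplitEquiv_apply`) + the SOCKET (C) model letters VERBATIM (`E′ c₁ hc₁ w₁ hw₁ Θ α lam`,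
`hjv hjfix hΘj hΘΘ hΘρ hvΘ hα hα1 hint hlam2 hρlam hΘlam hvlam`, the type letter `hlt : |α − ρα| < 1`) + the (C-0) data in datum currency `IsRamifiedQuadraticDatum ρ ϖM dρ tρ`,
`IsRamifiedQuadraticDatum Θ ϖΘ dΘ tΘ` (ANY two uniformisers of `M`) + the conductor level `hjl : |lam − ρlam| = |toPlace ϖ ^ jl·(ϖM − ρϖM)|` (★ RamMDep spelling at the `ρ`-datum's
uniformiser).  Conclusion: **`∃ n, 4·n + dΘ = 2·jl ∧ (q_w − 1)·(#Fix_{γ₂}(U₂ ⧸ K₂) + d % 2) + 2 = 2·q_w^{n+1}`**; `hSide_closedForm_ramM_hLevel` reads it with `dΘ = 2·g` as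
`jl % 2 = g % 2 ∧ (q_w − 1)·(#Fix + d % 2) + 2 = 2·q_w^{(jl − g)∕2 + 1}` (★ p857711's `hjl` binder and `Y_RM = 2[n_H + 1]_q`).
THE PROOF (all ★): ★ p857701 `hSide_closedForm_of_tube_exists` gives the torus datum `(u, w, z)` of the descent `g` of `γ₂`, `n`, `d_K` with the INERT∕EISENSTEIN disjunction, `|u² +
4w|_v = |ϖ_v|^{d_K}` and the level identity upstairs `|ϖ|_w^{2(2n + d_K)}·|tr γ₂|_w² = |4(tr² − 4det)|_w`.  INERT is impossible in type RamM: the residue degree of `M ∕ L⁺_v` is one —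
`exists_valued_sub_toPlace_toPlace_lt_one`, from the two data by fixed coordinates (★ `exists_fixed_coords_of_map_ne`, ★ `v_fixed_add_fixed_mul_le_one_iff`) — so ★ p857894
`false_of_inert_of_residue_approx` applies at `j = toPlace w.1 w₁ ∘ ι_w` (`|j y| = |y|⁴` by ★ `valued_toPlace_eq_sq_of_ramified` and the type-C dictionary) with the square root
`r₀ = μ − μ⁻¹` of ★ p857834 (`r₀² = j((u² + 4w)·z′²)`, `z′ = z·tr g∕det g`).  EISENSTEIN: FILE 1 `exists_kUniformizer` gives the `Θρ`-fixed `T` with `|T| = exp(−2)`, `|T − ρT| =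
|ϖM|^{2d_K}`; doubly fixed elements are `toPlace` of `σ_w`-fixed ones, of valuation in `exp(4ℤ)` (E-datum clause 4, `|toPlace a| = |a|²`); FILE 1's Klein letter gives `|ϖM − ρϖM|·|ϖM −
ΘϖM| = |T − ρT|`, i.e. **`dρ + dΘ = 2·d_K`** (★ p858036 §2 moves the `Θ`-datum to `ϖM`); ★ (C2-iii) `valued_pow_mul_add_sq_eq_of_level` + FILE 1's trace token + `hjl` (★
`valued_pow_eq_of_level`) + `|toPlace ϖ| = |ϖM|²` give `4(2n + d_K) = 4jl + 2dρ`; hence `4n + dΘ = 2jl`.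
(R-26) non-vacuity: the E1 RamM rows of F0P3a-p01 (g32) (e.g. `M = ℚ₂(ζ₈) ⊃ E = ℚ₂(i)`, `dρ = 4`, `dΘ = dτ = 2`, `d_K = 3`: `4 + 2 = 2·3` ✓, REF5 R5-208).
HONEST LABEL: HC_CM is proved only modulo the 7 printed citations (2 remaining named inputs: hLiu418 = stmt-HodgeConjecture-24832, h413 = stmt-HodgeConjecture-24833) until rung 0
closes; (ρ2b′-X) stays OPEN; count-neutral valuation bookkeeping — nothing printed is asserted.

## References
* [Kottwitz1988] R. E. Kottwitz, *Tamagawa numbers*, Ann. of Math. 127 (1988), §2 (orbital integrals of indicators as fixed-coset counts).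
* [LabesseLanglands1979] J.-P. Labesse, R. P. Langlands, *L-indistinguishability for SL(2)*, Canad. J. Math. 31 (1979), §2 pp. 7–8 (the three kinds of quadratic tori; conductor).
* [Rogawski1990] J. D. Rogawski, *Automorphic Representations of Unitary Groups in Three Variables*, Ann. of Math. Stud. 123 (1990), §4.9 Prop. 4.9.1 (b) p. 55, Lemma 4.9.3 p. 56.
* [Serre1979] J.-P. Serre, *Local Fields*, GTM 67 (1979), Ch. I §6 Prop. 18, Ch. III §4 Prop. 8, Ch. III §5 Thm. 3, Ch. IV §1 Prop. 4, Ch. XIV §4.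
-/

set_option autoImplicit false

noncomputable section

open WithZero
open scoped WithZero

namespace Summit.HodgeConjecture.HodgeConjecture.Cruxes.H413.F0P3cDyRamHSideClosedFormRamM

open Summit.HodgeConjecture.HodgeConjecture.Cruxes.H413.F0P3cDyRamFourthFieldLetters

/-! ## §2 The ramified CM place, type RamM: residue degree one, the fourth-field uniformiser, the level conversion, THE HEAD -/

section Place

open NumberField IsDedekindDomain MulAction Matrix ValuativeRel
open Literature.NumberTheory.Automorphic Literature.NumberTheory.Automorphic.UnitaryGroup
open Literature.NumberTheory.Automorphic.UnitaryThreeFourFrame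
open Literature.NumberTheory.Automorphic.HermitianLatticeTree
open Summit.HodgeConjecture.HodgeConjecture.Cruxes.H413.F0P3cDyRamHSideClosedForm
open Summit.HodgeConjecture.HodgeConjecture.Cruxes.H413.F0P3cDyRamHSideLevelLetter
open Summit.HodgeConjecture.HodgeConjecture.Cruxes.H413.F0P3cDyRamHSideDescentRatio
open Summit.HodgeConjecture.HodgeConjecture.Cruxes.H413.F0P3cDyRamUnramifiedQuadraticCompletionDictionary
open scoped Matrix MatrixGroups ValuativeRel

variable (L : Type) [Field L] [NumberField L] [IsCMField L] (v : HeightOneSpectrum (𝓞 ↥(maximalRealSubfield L)))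
  (w : PlacesOver L v) (hw : IsCMField.complexConj L • w.1 = w.1)
  {ϖF : v.adicCompletion ↥(maximalRealSubfield L)} (hϖF : Valued.v ϖF = exp (-1 : ℤ))

include hw in
/-- **RESIDUE DEGREE ONE IN TYPE RamM, as a residue-approximation letter**: with the E-datum `(σ_w, ϖ, d)` on `L_w` (`he`) and a `ρ`-datum `(ϖM, dρ)` on the line model `M`
(`ρ`-fixed points `= toPlace(L_w)`, `|toPlace a| ≤ 1 ↔ |a| ≤ 1`), every integer `x` of `M` is within distance `< 1` of `j c` for an integer `c` of `L⁺_v`, `j = toPlace w.1 w₁ ∘ ι_w`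
(fixed coordinates twice: `x = a + b·ϖM`, `a = ι c + b₂·ϖ`; ★ `exists_fixed_coords_of_map_ne`, ★ `v_fixed_add_fixed_mul_le_one_iff`). [cite: Serre1979, Ch. I §6 Prop. 18; Ch. III §5] -/
theorem exists_valued_sub_toPlace_toPlace_lt_one (he : v.asIdeal.ramificationIdx' w.1.asIdeal ≠ 1)
    {ϖ : w.1.adicCompletion L} {d tE : ℕ} (hD : IsRamifiedQuadraticDatum (galAdicCompletionMap (L := L) (IsCMField.complexConj L) hw) ϖ d tE)
    (E' : Type) [Field E'] [NumberField E'] [Algebra L E'] [Algebra.IsQuadraticExtension L E'] (c₁ : E' ≃ₐ[L] E')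
    (w₁ : PlacesOver E' w.1) (hw₁ : c₁ • w₁.1 = w₁.1)
    (hjv : ∀ a, Valued.v (toPlace w.1 w₁ a) ≤ 1 ↔ Valued.v a ≤ 1)
    (hjfix : ∀ z : (w₁.1.adicCompletion E'), galAdicCompletionMap (L := E') c₁ hw₁ z = z ↔ ∃ a, toPlace w.1 w₁ a = z)
    {ϖM : w₁.1.adicCompletion E'} {dρ tρ : ℕ} (hDρ : IsRamifiedQuadraticDatum (galAdicCompletionMap (L := E') c₁ hw₁) ϖM dρ tρ)
    (x : w₁.1.adicCompletion E') (hx : Valued.v x ≤ 1) :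
    ∃ c : v.adicCompletion ↥(maximalRealSubfield L), Valued.v c ≤ 1 ∧ Valued.v (x - toPlace w.1 w₁ (toPlace v w c)) < 1 := by
  obtain ⟨hρρ, -, hϖM, hfixρ, hdρ, -, -⟩ := hDρ
  obtain ⟨hσσ, -, hϖ, hfixσ, hdE, -, -⟩ := hD
  have hϖM0 : ϖM ≠ 0 := fun h => by rw [h, map_zero] at hϖM; exact (coe_ne_zero hϖM.symm).elim
  have hϖ0 : ϖ ≠ 0 := fun h => by rw [h, map_zero] at hϖ; exact (coe_ne_zero hϖ.symm).elim
  have hϖMne : galAdicCompletionMap (L := E') c₁ hw₁ ϖM ≠ ϖM := by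
    intro h
    rw [h, sub_self, map_zero] at hdρ
    exact pow_ne_zero dρ ((Valuation.ne_zero_iff _).2 hϖM0) hdρ.symm
  have hϖne : (galAdicCompletionMap (L := L) (IsCMField.complexConj L) hw) ϖ ≠ ϖ := by
    intro h
    rw [h, sub_self, map_zero] at hdE
    exact pow_ne_zero d ((Valuation.ne_zero_iff _).2 hϖ0) hdE.symm
  -- coordinates in `M` over `L_w`
  obtain ⟨a, b, ha, hb, hxab⟩ := Literature.NumberTheory.LocalFields.exists_fixed_coords_of_map_ne hρρ hϖMne x
  obtain ⟨ha1, hb1⟩ := (Literature.NumberTheory.LocalFields.v_fixed_add_fixed_mul_le_one_iff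
    (Literature.NumberTheory.LocalFields.WildQuadraticDatum.even_log_v_of_fixed hfixρ) hϖM ha hb).1 (by rw [← hxab]; exact hx)
  obtain ⟨a₁, ha₁⟩ := (hjfix a).1 ha
  have ha₁1 : Valued.v a₁ ≤ 1 := (hjv a₁).1 (by rw [ha₁]; exact ha1)
  -- coordinates in `L_w` over `L⁺_v`
  obtain ⟨a₂, b₂, ha₂, hb₂, ha₁ab⟩ := Literature.NumberTheory.LocalFields.exists_fixed_coords_of_map_ne hσσ hϖne a₁
  obtain ⟨ha₂1, hb₂1⟩ := (Literature.NumberTheory.LocalFields.v_fixed_add_fixed_mul_le_one_iff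
    (Literature.NumberTheory.LocalFields.WildQuadraticDatum.even_log_v_of_fixed hfixσ) hϖ ha₂ hb₂).1 (by rw [← ha₁ab]; exact ha₁1)
  obtain ⟨c, hc⟩ := exists_toPlace_eq_of_galAdicCompletionMap_eq (IsCMField.complexConj L) w (IsCMField.complexConj_ne_one L) hw a₂ ha₂
  have hc1 : Valued.v c ≤ 1 := by
    have h2 : Valued.v c ^ 2 ≤ 1 := by rw [← valued_toPlace_eq_sq_of_ramified L v w hw he c, hc]; exact ha₂1
    by_contra hgt
    rw [not_le] at hgt
    exact absurd (one_lt_pow₀ hgt two_ne_zero) (not_lt.2 h2)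
  refine ⟨c, hc1, ?_⟩
  have hdec : x - toPlace w.1 w₁ (toPlace v w c) = toPlace w.1 w₁ b₂ * toPlace w.1 w₁ ϖ + b * ϖM := by
    rw [hxab, ← ha₁, ha₁ab, ← hc, map_add, map_mul]; ring
  obtain ⟨-, hjϖ1⟩ := valued_map_pos_and_lt_one (toPlace w.1 w₁) hjv hϖ0 (by rw [hϖ, ← exp_zero, exp_lt_exp]; norm_num)
  have h1 : Valued.v (toPlace w.1 w₁ b₂ * toPlace w.1 w₁ ϖ) < 1 := by
    rw [Valuation.map_mul]
    calc Valued.v (toPlace w.1 w₁ b₂) * Valued.v (toPlace w.1 w₁ ϖ) ≤ 1 * Valued.v (toPlace w.1 w₁ ϖ) := mul_le_mul_left ((hjv b₂).2 hb₂1) _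
      _ < 1 := by rw [one_mul]; exact hjϖ1
  have h2 : Valued.v (b * ϖM) < 1 := by
    rw [Valuation.map_mul, hϖM]
    calc Valued.v b * exp (-1 : ℤ) ≤ 1 * exp (-1 : ℤ) := mul_le_mul_left hb1 _
      _ < 1 := by rw [one_mul, ← exp_zero, exp_lt_exp]; norm_num
  rw [hdec]
  exact lt_of_le_of_lt (Valuation.map_add _ _ _) (max_lt h1 h2)

include hw hϖF in
/-- **(C-6) THE H-SIDE CLOSED FORM OF (ρ2b′-X), TYPE RamM — HEAD.**  At a ramified CM place `w ∣ v` (`he`, E-datum `hD`), let `γ₂ ∈ U₂(L⁺_v)` be of type (2) (`hirr`) in the tube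
(`htube`), and let the line model `M = E′_{w₁}` (`ρ = c₁ ⊗ 1`, `Θ`, generator `α`, eigenvalue `lam` with its package relations — the letters of socket (C) VERBATIM) be of TYPE RamM:
`|α − ρα| < 1`.  Then for the (C-0) data — a `ρ`-datum `(ϖM, dρ)` and a `Θ`-datum `(ϖΘ, dΘ)` on `M` — and the conductor level `jl` of `lam` (`hjl`, ★ RamMDep spelling):
**there is `n : ℕ` with `4·n + dΘ = 2·jl` and `(q_w − 1)·(#Fix_{γ₂}(U₂ ⧸ K₂) + d % 2) + 2 = 2·q_w^{n+1}`** — the EISENSTEIN law of ★ `hSide_closedForm_of_tube_exists` (its INERT branch is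
refuted in type RamM by residue degree one, ★ `false_of_inert_of_residue_approx`), with its level `n` converted by ★ (C2-iii) and the Klein letter at the fourth field `dρ + dΘ = 2·d_K`
(§1, `T` = the `Θρ`-fixed uniformiser built from the Eisenstein datum and the ratio witness `r₀ = μ − μ⁻¹` of ★ (C2-vi)).  With `dΘ = 2g`: `n = (jl − g)∕2`, `jl ≡ g (mod 2)` — the
H-LEVEL BINDER `2·n_H = jl − g` of ★ `toricCensusSum_ramM`.
[cite: Kottwitz1988, §2] [cite: LabesseLanglands1979, §2 pp. 7–8] [cite: Rogawski1990, §4.9 Prop. 4.9.1 (b) p. 55, Lemma 4.9.3 p. 56] [cite: Serre1979, Ch. III §4 Prop. 8; Ch. III §5; Ch. IV §1 Prop. 4; Ch. XIV §4] -/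
theorem hSide_closedForm_ramM [Finite (IsLocalRing.ResidueField 𝒪[v.adicCompletion ↥(maximalRealSubfield L)])] [Fintype (Valued.ResidueField (w.1.adicCompletion L))]
    (he : v.asIdeal.ramificationIdx' w.1.asIdeal ≠ 1)
    {ϖ : w.1.adicCompletion L} {d tE : ℕ} (hD : IsRamifiedQuadraticDatum (galAdicCompletionMap (L := L) (IsCMField.complexConj L) hw) ϖ d tE)
    (γ₂ : ((cmDatum L 2 (Matrix.of fun i j : Fin 2 => if i.val + j.val + 1 = 2 then (1 : L) else 0)).Local v))
    (hirr : ¬ ∃ x : (w.1.adicCompletion L), (((((localNonsplitEquiv (IsCMField.complexConj L) (Matrix.of fun i j : Fin 2 => if i.val + j.val + 1 = 2 then (1 : L) else 0) (IsCMField.complexConj_ne_one L) w hw) γ₂ : ↥(unitaryGroupOfForm (galAdicCompletionMap (L := L) (IsCMField.complexConj L) hw) (placeForm (Matrix.of fun i j : Fin 2 => if i.val + j.val + 1 = 2 then (1 : L) else 0) w.1))) : GL (Fin 2) (w.1.adicCompletion L)) : Matrix (Fin 2) (Fin 2) (w.1.adicCompletion L))).charpoly.IsRoot x)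
    (htube : Valued.v ((((((localNonsplitEquiv (IsCMField.complexConj L) (Matrix.of fun i j : Fin 2 => if i.val + j.val + 1 = 2 then (1 : L) else 0) (IsCMField.complexConj_ne_one L) w hw) γ₂ : ↥(unitaryGroupOfForm (galAdicCompletionMap (L := L) (IsCMField.complexConj L) hw) (placeForm (Matrix.of fun i j : Fin 2 => if i.val + j.val + 1 = 2 then (1 : L) else 0) w.1))) : GL (Fin 2) (w.1.adicCompletion L)) : Matrix (Fin 2) (Fin 2) (w.1.adicCompletion L))).trace ^ 2 - 4 * (((((localNonsplitEquiv (IsCMField.complexConj L) (Matrix.of fun i j : Fin 2 => if i.val + j.val + 1 = 2 then (1 : L) else 0) (IsCMField.complexConj_ne_one L) w hw) γ₂ : ↥(unitaryGroupOfForm (galAdicCompletionMap (L := L) (IsCMField.complexConj L) hw) (placeForm (Matrix.of fun i j : Fin 2 => if i.val + j.val + 1 = 2 then (1 : L) else 0) w.1))) : GL (Fin 2) (w.1.adicCompletion L)) : Matrix (Fin 2) (Fin 2) (w.1.adicCompletion L))).det) < Valued.v (4 : w.1.adicCompletion L) * Valued.v ϖ ^ 2 * Valued.v (((((localNonsplitEquiv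 (IsCMField.complexConj L) (Matrix.of fun i j : Fin 2 => if i.val + j.val + 1 = 2 then (1 : L) else 0) (IsCMField.complexConj_ne_one L) w hw) γ₂ : ↥(unitaryGroupOfForm (galAdicCompletionMap (L := L) (IsCMField.complexConj L) hw) (placeForm (Matrix.of fun i j : Fin 2 => if i.val + j.val + 1 = 2 then (1 : L) else 0) w.1))) : GL (Fin 2) (w.1.adicCompletion L)) : Matrix (Fin 2) (Fin 2) (w.1.adicCompletion L))).trace ^ 2)
    -- the line model `M = E′_{w₁}` (socket (C) letters)
    (E' : Type) [Field E'] [NumberField E'] [Algebra L E'] [Algebra.IsQuadraticExtension L E'] (c₁ : E' ≃ₐ[L] E') (hc₁ : c₁ ≠ 1)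
    (w₁ : PlacesOver E' w.1) (hw₁ : c₁ • w₁.1 = w₁.1)
    (Θ : (w₁.1.adicCompletion E') →+* (w₁.1.adicCompletion E')) {α lam : w₁.1.adicCompletion E'}
    (hjv : ∀ a, Valued.v (toPlace w.1 w₁ a) ≤ 1 ↔ Valued.v a ≤ 1)
    (hjfix : ∀ z : (w₁.1.adicCompletion E'), galAdicCompletionMap (L := E') c₁ hw₁ z = z ↔ ∃ a, toPlace w.1 w₁ a = z)
    (hΘj : ∀ a, Θ (toPlace w.1 w₁ a) = toPlace w.1 w₁ ((galAdicCompletionMap (L := L) (IsCMField.complexConj L) hw) a))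
    (hΘΘ : ∀ z, Θ (Θ z) = z) (hΘρ : ∀ z, Θ (galAdicCompletionMap (L := E') c₁ hw₁ z) = galAdicCompletionMap (L := E') c₁ hw₁ (Θ z)) (hvΘ : ∀ z, Valued.v (Θ z) = Valued.v z)
    (hα : galAdicCompletionMap (L := E') c₁ hw₁ α ≠ α) (hα1 : Valued.v α ≤ 1)
    (hint : ∀ z : (w₁.1.adicCompletion E'), Valued.v z ≤ 1 → Valued.v ((z - galAdicCompletionMap (L := E') c₁ hw₁ z) / (α - galAdicCompletionMap (L := E') c₁ hw₁ α)) ≤ 1)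
    (hlam2 : lam * lam = toPlace w.1 w₁ (((((localNonsplitEquiv (IsCMField.complexConj L) (Matrix.of fun i j : Fin 2 => if i.val + j.val + 1 = 2 then (1 : L) else 0) (IsCMField.complexConj_ne_one L) w hw) γ₂ : ↥(unitaryGroupOfForm (galAdicCompletionMap (L := L) (IsCMField.complexConj L) hw) (placeForm (Matrix.of fun i j : Fin 2 => if i.val + j.val + 1 = 2 then (1 : L) else 0) w.1))) : GL (Fin 2) (w.1.adicCompletion L)) : Matrix (Fin 2) (Fin 2) (w.1.adicCompletion L))).trace * lam - toPlace w.1 w₁ (((((localNonsplitEquiv (IsCMField.complexConj L) (Matrix.of fun i j : Fin 2 => if i.val + j.val + 1 = 2 then (1 : L) else 0) (IsCMField.complexConj_ne_one L) w hw) γ₂ : ↥(unitaryGroupOfForm (galAdicCompletionMap (L := L) (IsCMField.complexConj L) hw) (placeForm (Matrix.of fun i j : Fin 2 => if i.val + j.val + 1 = 2 then (1 : L) else 0) w.1))) : GL (Fin 2) (w.1.adicCompletion L)) : Matrix (Fin 2) (Fin 2) (w.1.adicCompletion L))).det)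
    (hρlam : galAdicCompletionMap (L := E') c₁ hw₁ lam = toPlace w.1 w₁ (((((localNonsplitEquiv (IsCMField.complexConj L) (Matrix.of fun i j : Fin 2 => if i.val + j.val + 1 = 2 then (1 : L) else 0) (IsCMField.complexConj_ne_one L) w hw) γ₂ : ↥(unitaryGroupOfForm (galAdicCompletionMap (L := L) (IsCMField.complexConj L) hw) (placeForm (Matrix.of fun i j : Fin 2 => if i.val + j.val + 1 = 2 then (1 : L) else 0) w.1))) : GL (Fin 2) (w.1.adicCompletion L)) : Matrix (Fin 2) (Fin 2) (w.1.adicCompletion L))).trace - lam)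
    (hΘlam : Θ lam * lam = 1) (hvlam : Valued.v lam = 1)
    -- TYPE RamM
    (hlt : Valued.v (α - galAdicCompletionMap (L := E') c₁ hw₁ α) < 1)
    -- the (C-0) data on `M`: a `ρ`-datum and a `Θ`-datum (any uniformisers)
    {ϖM ϖΘ : w₁.1.adicCompletion E'} {dρ tρ dΘ tΘ : ℕ} (hDρ : IsRamifiedQuadraticDatum (galAdicCompletionMap (L := E') c₁ hw₁) ϖM dρ tρ) (hDΘ : IsRamifiedQuadraticDatum Θ ϖΘ dΘ tΘ)
    -- the conductor level of `lam` (★ RamMDep spelling)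
    {jl : ℕ} (hjl : Valued.v (lam - galAdicCompletionMap (L := E') c₁ hw₁ lam) = Valued.v (toPlace w.1 w₁ ϖ ^ jl * (ϖM - galAdicCompletionMap (L := E') c₁ hw₁ ϖM))) :
    ∃ n : ℕ, 4 * n + dΘ = 2 * jl ∧
      (Fintype.card (Valued.ResidueField (w.1.adicCompletion L)) - 1) *
          (Nat.card (fixedBy (((cmDatum L 2 (Matrix.of fun i j : Fin 2 => if i.val + j.val + 1 = 2 then (1 : L) else 0)).Local v) ⧸
                cmLocalIntegralLevel L 2 (Matrix.of fun i j : Fin 2 => if i.val + j.val + 1 = 2 then (1 : L) else 0) v) γ₂) + d % 2) + 2 =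
        2 * Fintype.card (Valued.ResidueField (w.1.adicCompletion L)) ^ (n + 1) := by
  classical
  -- ★ p857701: the datum and the class disjunction (before abbreviating, so that `set` rewrites its letters too)
  obtain ⟨α₀, s, g, uτ, wτ, z, n, dK, -, hvα₀, hs, hsg, hz, hmain, hu, hdat, hdK, hlev⟩ :=
    hSide_closedForm_of_tube_exists L v w hw hϖF he hD γ₂ hirr htube
  set U : Matrix (Fin 2) (Fin 2) (w.1.adicCompletion L) :=
    ((((localNonsplitEquiv (IsCMField.complexConj L) (Matrix.of fun i j : Fin 2 => if i.val + j.val + 1 = 2 then (1 : L) else 0) (IsCMField.complexConj_ne_one L) w hw) γ₂ : ↥(unitaryGroupOfForm (galAdicCompletionMap (L := L) (IsCMField.complexConj L) hw) (placeForm (Matrix.of fun i j : Fin 2 => if i.val + j.val + 1 = 2 then (1 : L) else 0) w.1))) : GL (Fin 2) (w.1.adicCompletion L)) : Matrix (Fin 2) (Fin 2) (w.1.adicCompletion L)) with hU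
  set jE : (w.1.adicCompletion L) →+* (w₁.1.adicCompletion E') := toPlace w.1 w₁ with hjE
  set ι : (v.adicCompletion ↥(maximalRealSubfield L)) →+* (w.1.adicCompletion L) := toPlace v w with hι
  set ρ : (w₁.1.adicCompletion E') →+* (w₁.1.adicCompletion E') := galAdicCompletionMap (L := E') c₁ hw₁ with hρ
  -- characteristic zero
  haveI : CharZero (w₁.1.adicCompletion E') := charZero_of_injective_algebraMap (algebraMap E' (w₁.1.adicCompletion E')).injective
  have h2M : (2 : w₁.1.adicCompletion E') ≠ 0 := two_ne_zero
  -- datum clauses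
  obtain ⟨hρρ, hvρ, hϖM, hfixρ, hdρv, -, -⟩ := id hDρ
  obtain ⟨hΘΘ', hvΘ', hϖΘ, hfixΘ, hdΘv, -, -⟩ := id hDΘ
  have hϖ : Valued.v ϖ = exp (-1 : ℤ) := hD.2.2.1
  have hfixσ := hD.2.2.2.1
  have hϖ0 : ϖ ≠ 0 := fun h => by rw [h, map_zero] at hϖ; exact (coe_ne_zero hϖ.symm).elim
  have hϖM0 : ϖM ≠ 0 := fun h => by rw [h, map_zero] at hϖM; exact (coe_ne_zero hϖM.symm).elim
  have hlam0 : lam ≠ 0 := fun h => by rw [h, map_zero] at hvlam; exact zero_ne_one hvlam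
  -- the type-C dictionary: `|jE a| = |a|²`, `|ι y| = |y|²`
  have hjE2 : ∀ a, Valued.v (jE a) = Valued.v a ^ 2 := fun a =>
    valued_toPlace_eq_sq_of_v_sub_galAdicCompletionMap_lt_one E' c₁ w.1 hc₁ w₁ hw₁ hα hα1 hint hlt a
  have hι2 : ∀ y, Valued.v (ι y) = Valued.v y ^ 2 := valued_toPlace_eq_sq_of_ramified L v w hw he
  have hjEϖ : Valued.v (jE ϖ) = Valued.v ϖM ^ 2 := by rw [hjE2, hϖ, hϖM]
  have hα₀0 : α₀ ≠ 0 := by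
    rcases hvα₀ with h | h
    · exact fun h0 => by rw [h0, map_zero] at h; exact zero_ne_one h
    · exact fun h0 => by rw [h0, map_zero] at h; exact (coe_ne_zero h.symm).elim
  have hGdet : (g : Matrix (Fin 2) (Fin 2) (v.adicCompletion ↥(maximalRealSubfield L))).det ≠ 0 :=
    ((Matrix.isUnit_iff_isUnit_det _).1 g.isUnit).ne_zero
  -- eigen-package algebra
  obtain ⟨hsum, -⟩ := add_map_eq_and_sub_map_sq_eq jE ρ hlam2 hρlam
  have hprodlam := lam_mul_map_lam jE ρ hlam2 hρlam
  have hD0 : U.det ≠ 0 := by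
    intro h0
    rw [h0, map_zero, mul_eq_zero] at hprodlam
    rcases hprodlam with h | h
    · exact hlam0 h
    · exact hlam0 (by rw [← hρρ lam, h, map_zero])
  -- THE TRACE TOKEN `|lam + ρlam| = |2|` from the tube
  have htr : Valued.v (lam + ρ lam) = Valued.v (2 : w₁.1.adicCompletion E') :=
    valued_add_map_eq_two_of_tube ρ jE hjE2 hlam2 hρlam hvlam (by rw [hϖ, ← exp_zero, exp_le_exp]; norm_num) htube
  have htr0 : U.trace ≠ 0 := by
    intro h0
    rw [h0, map_zero] at hsum
    rw [hsum, map_zero] at htr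
    exact h2M ((Valuation.zero_iff _).1 htr.symm)
  have hgtr : (g : Matrix (Fin 2) (Fin 2) (v.adicCompletion ↥(maximalRealSubfield L))).trace ≠ 0 := by
    intro h0
    apply htr0
    rw [trace_eq_smul_of_descent ι hα₀0 hsg, h0, map_zero, mul_zero]
  -- the ratio witness `r₀` and the datum pushed into `M`
  have hρr : ρ (lam / ρ lam - (lam / ρ lam)⁻¹) = -(lam / ρ lam - (lam / ρ lam)⁻¹) := map_ratioWitness_eq_neg ρ hρρ lam
  have hΘρr : Θ (ρ (lam / ρ lam - (lam / ρ lam)⁻¹)) = lam / ρ lam - (lam / ρ lam)⁻¹ := map_map_ratioWitness_eq ρ Θ hΘlam hΘρ hρρ hlam0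
  set z' : v.adicCompletion ↥(maximalRealSubfield L) := z * (g : Matrix (Fin 2) (Fin 2) (v.adicCompletion ↥(maximalRealSubfield L))).trace /
    (g : Matrix (Fin 2) (Fin 2) (v.adicCompletion ↥(maximalRealSubfield L))).det with hz'
  have hz'0 : z' ≠ 0 := div_ne_zero (mul_ne_zero hz hgtr) hGdet
  set j : (v.adicCompletion ↥(maximalRealSubfield L)) →+* (w₁.1.adicCompletion E') := jE.comp ι with hj
  have hr : (lam / ρ lam - (lam / ρ lam)⁻¹) ^ 2 = j ((uτ ^ 2 + 4 * wτ) * z' ^ 2) := by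
    rw [ratioWitness_sq_eq jE ρ hlam2 hρlam hD0 hlam0, discTraceSqDivDetSq_eq_map_of_descent ι hα₀0 hs hsg hGdet, ← disc_mul_sq_eq hmain hGdet,
      hj, RingHom.comp_apply]
  have hj4 : ∀ y, Valued.v (j y) = Valued.v y ^ 4 := fun y => by
    rw [hj, RingHom.comp_apply, hjE2, hι2, ← pow_mul]
  have hjρ : ∀ y, ρ (j y) = j y := fun y => by rw [hj, RingHom.comp_apply]; exact (hjfix _).2 ⟨_, rfl⟩
  have hjΘ : ∀ y, Θ (j y) = j y := fun y => by
    rw [hj, RingHom.comp_apply, hΘj, hι, galAdicCompletionMap_toPlace (IsCMField.complexConj L) w w hw]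
  rcases hdat with ⟨hwτ, hanis, -, -⟩ | ⟨hu1, hw1, hlaw⟩
  · ---------------------------------------------------------------- INERT: impossible in type RamM (residue degree one)
    exfalso
    have hres : ∀ x : w₁.1.adicCompletion E', Valued.v x ≤ 1 → ∃ c : v.adicCompletion ↥(maximalRealSubfield L), Valued.v c ≤ 1 ∧ Valued.v (x - j c) < 1 :=
      fun x hx => exists_valued_sub_toPlace_toPlace_lt_one L v w hw he hD E' c₁ w₁ hw₁ hjv hjfix hDρ x hx
    exact false_of_inert_of_residue_approx j hj4 hres h2M (D := (uτ ^ 2 + 4 * wτ) * z' ^ 2) rfl hz'0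
      ((v_le_one_iff_mem_integer uτ).2 hu) ((v_le_one_iff_mem_integer wτ).2 hwτ)
      (fun c e hc hee hlt1 => by
        have h := hanis c e ((v_le_one_iff_mem_integer c).1 hc) ((v_le_one_iff_mem_integer e).1 hee) ((v_lt_one_iff_valuation_lt_one _).1 hlt1)
        exact ⟨(v_lt_one_iff_valuation_lt_one c).2 h.1, (v_lt_one_iff_valuation_lt_one e).2 h.2⟩) hr
  · ---------------------------------------------------------------- EISENSTEIN: the law, and the level conversion
    have hvw : Valued.v wτ = exp (-1 : ℤ) := by rw [(v_eq_iff_valuation_eq wτ ϖF).2 hw1, hϖF]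
    have hvu : Valued.v uτ ≤ exp (-1 : ℤ) := by
      have hlt1 := (v_lt_one_iff_valuation_lt_one uτ).2 hu1
      rcases eq_or_ne (Valued.v uτ) 0 with h0 | h0
      · rw [h0]; exact zero_le
      · rw [← exp_log h0, ← exp_zero, exp_lt_exp] at hlt1
        rw [← exp_log h0, exp_le_exp]
        omega
    have hdKv : Valued.v (uτ ^ 2 + 4 * wτ) = Valued.v ϖF ^ dK := by
      have h := (v_eq_iff_valuation_eq (uτ ^ 2 + 4 * wτ) (ϖF ^ dK)).2 (by rw [map_pow]; exact hdK)
      rwa [map_pow] at h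
    -- the fourth-field uniformiser `T`
    obtain ⟨T, hΘρT, hvT, hTρT⟩ := exists_kUniformizer ρ Θ j h2M hj4 hjρ hjΘ hρr hΘρr hz'0 hr hvw hvu hϖF hdKv
    rw [← hϖM] at hTρT
    -- doubly fixed elements have valuation in `exp(4ℤ)`
    have hfix4 : ∀ x : w₁.1.adicCompletion E', ρ x = x → Θ x = x → x ≠ 0 → ∃ m : ℤ, Valued.v x = exp (4 * m) := by
      intro x hρx hΘx hx0
      obtain ⟨a, ha⟩ := (hjfix x).1 hρx
      have hσa : (galAdicCompletionMap (L := L) (IsCMField.complexConj L) hw) a = a := by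
        apply jE.injective
        rw [← hΘj, ha, hΘx]
      have ha0 : a ≠ 0 := fun h => hx0 (by rw [← ha, h, map_zero])
      obtain ⟨m, hm⟩ := hfixσ a hσa ha0
      refine ⟨m, ?_⟩
      rw [← ha, hjE2, hm, ← WithZero.exp_nsmul]
      congr 1; ring
    -- THE KLEIN LETTER AT THE FOURTH FIELD: `dρ + dΘ = 2·dK`
    have hK := v_sub_mul_v_sub_eq_of_kUniformizer ρ Θ hρρ hΘΘ hΘρ hvρ hvΘ hfix4 hΘρT hvT hϖM
    have hdΘM : Valued.v (ϖM - Θ ϖM) = Valued.v ϖM ^ dΘ := by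
      have h := F0P3cDyRamKleinDifferentLetters.v_sub_map_eq_of_uniformizer hΘΘ' hvΘ' hfixΘ hϖΘ hdΘv (y := ϖM) (by rw [hϖM, hϖΘ])
      rwa [hϖΘ, ← hϖM] at h
    -- exponents of `|ϖM|` are read off injectively
    have hϖMpos : 0 < Valued.v ϖM := (Valuation.pos_iff _).2 hϖM0
    have hϖMlt : Valued.v ϖM < 1 := by rw [hϖM, ← exp_zero, exp_lt_exp]; norm_num
    have hinj0 : Function.Injective (fun m : ℕ => Valued.v ϖM ^ m) := (pow_right_strictAnti₀ hϖMpos hϖMlt).injective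
    have hinj : ∀ a b : ℕ, Valued.v ϖM ^ a = Valued.v ϖM ^ b → a = b := fun a b h => hinj0 h
    have hsumd : dρ + dΘ = 2 * dK := by
      refine hinj _ _ ?_
      rw [pow_add, ← hdρv, ← hdΘM, hK, hTρT]
    -- THE LEVEL CONVERSION: `2·(2n + dK) = 2·jl + dρ`
    have hmaster := valued_pow_mul_add_sq_eq_of_level jE hjv ρ hlam2 hρlam hlev
    have hjl' : Valued.v (lam - ρ lam) = Valued.v (jE ϖ) ^ jl * Valued.v (ϖM - ρ ϖM) := by
      rw [hjl, Valuation.map_mul, Valuation.map_pow]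
    have hlevel := valued_pow_eq_of_level h2M hmaster htr hjl'
    have hk : 2 * (2 * (2 * n + dK)) = 2 * (2 * jl) + dρ * 2 := by
      refine hinj _ _ ?_
      calc Valued.v ϖM ^ (2 * (2 * (2 * n + dK))) = (Valued.v ϖM ^ 2) ^ (2 * (2 * n + dK)) := by rw [pow_mul]
        _ = Valued.v (jE ϖ) ^ (2 * jl) * Valued.v (ϖM - ρ ϖM) ^ 2 := by rw [← hjEϖ]; exact hlevel
        _ = (Valued.v ϖM ^ 2) ^ (2 * jl) * (Valued.v ϖM ^ dρ) ^ 2 := by rw [hjEϖ, hdρv]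
        _ = Valued.v ϖM ^ (2 * (2 * jl) + dρ * 2) := by rw [← pow_mul, ← pow_mul, ← pow_add]
    exact ⟨n, by omega, hlaw⟩

include hw hϖF in
/-- **(C-6) IN THE LETTERS OF ★ `toricCensusSum_ramM`**: with the parity letter `dΘ = 2·g` (★ p858036 §4), the head reads `jl % 2 = g % 2` (★ p857711's binder `hjl`) and
`(q_w − 1)·(#Fix_{γ₂}(U₂ ⧸ K₂) + d % 2) + 2 = 2·q_w^{(jl − g)∕2 + 1}` (`= (q − 1)·Y_RM + 2`, `Y_RM = 2[n_H + 1]_q`, `2·n_H = jl − g`).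
[cite: Kottwitz1988, §2] [cite: LabesseLanglands1979, §2 pp. 7–8] [cite: Rogawski1990, §4.9 Prop. 4.9.1 (b) p. 55, Lemma 4.9.3 p. 56] [cite: Serre1979, Ch. III §4 Prop. 8; Ch. IV §1 Prop. 4] -/
theorem hSide_closedForm_ramM_hLevel [Finite (IsLocalRing.ResidueField 𝒪[v.adicCompletion ↥(maximalRealSubfield L)])] [Fintype (Valued.ResidueField (w.1.adicCompletion L))]
    (he : v.asIdeal.ramificationIdx' w.1.asIdeal ≠ 1)
    {ϖ : w.1.adicCompletion L} {d tE : ℕ} (hD : IsRamifiedQuadraticDatum (galAdicCompletionMap (L := L) (IsCMField.complexConj L) hw) ϖ d tE)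
    (γ₂ : ((cmDatum L 2 (Matrix.of fun i j : Fin 2 => if i.val + j.val + 1 = 2 then (1 : L) else 0)).Local v))
    (hirr : ¬ ∃ x : (w.1.adicCompletion L), (((((localNonsplitEquiv (IsCMField.complexConj L) (Matrix.of fun i j : Fin 2 => if i.val + j.val + 1 = 2 then (1 : L) else 0) (IsCMField.complexConj_ne_one L) w hw) γ₂ : ↥(unitaryGroupOfForm (galAdicCompletionMap (L := L) (IsCMField.complexConj L) hw) (placeForm (Matrix.of fun i j : Fin 2 => if i.val + j.val + 1 = 2 then (1 : L) else 0) w.1))) : GL (Fin 2) (w.1.adicCompletion L)) : Matrix (Fin 2) (Fin 2) (w.1.adicCompletion L))).charpoly.IsRoot x)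
    (htube : Valued.v ((((((localNonsplitEquiv (IsCMField.complexConj L) (Matrix.of fun i j : Fin 2 => if i.val + j.val + 1 = 2 then (1 : L) else 0) (IsCMField.complexConj_ne_one L) w hw) γ₂ : ↥(unitaryGroupOfForm (galAdicCompletionMap (L := L) (IsCMField.complexConj L) hw) (placeForm (Matrix.of fun i j : Fin 2 => if i.val + j.val + 1 = 2 then (1 : L) else 0) w.1))) : GL (Fin 2) (w.1.adicCompletion L)) : Matrix (Fin 2) (Fin 2) (w.1.adicCompletion L))).trace ^ 2 - 4 * (((((localNonsplitEquiv (IsCMField.complexConj L) (Matrix.of fun i j : Fin 2 => if i.val + j.val + 1 = 2 then (1 : L) else 0) (IsCMField.complexConj_ne_one L) w hw) γ₂ : ↥(unitaryGroupOfForm (galAdicCompletionMap (L := L) (IsCMField.complexConj L) hw) (placeForm (Matrix.of fun i j : Fin 2 => if i.val + j.val + 1 = 2 then (1 : L) else 0) w.1))) : GL (Fin 2) (w.1.adicCompletion L)) : Matrix (Fin 2) (Fin 2) (w.1.adicCompletion L))).det) < Valued.v (4 : w.1.adicCompletion L) * Valued.v ϖ ^ 2 * Valued.v (((((localNonsplitEquiv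 (IsCMField.complexConj L) (Matrix.of fun i j : Fin 2 => if i.val + j.val + 1 = 2 then (1 : L) else 0) (IsCMField.complexConj_ne_one L) w hw) γ₂ : ↥(unitaryGroupOfForm (galAdicCompletionMap (L := L) (IsCMField.complexConj L) hw) (placeForm (Matrix.of fun i j : Fin 2 => if i.val + j.val + 1 = 2 then (1 : L) else 0) w.1))) : GL (Fin 2) (w.1.adicCompletion L)) : Matrix (Fin 2) (Fin 2) (w.1.adicCompletion L))).trace ^ 2)
    -- the line model `M = E′_{w₁}` (socket (C) letters)
    (E' : Type) [Field E'] [NumberField E'] [Algebra L E'] [Algebra.IsQuadraticExtension L E'] (c₁ : E' ≃ₐ[L] E') (hc₁ : c₁ ≠ 1)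
    (w₁ : PlacesOver E' w.1) (hw₁ : c₁ • w₁.1 = w₁.1)
    (Θ : (w₁.1.adicCompletion E') →+* (w₁.1.adicCompletion E')) {α lam : w₁.1.adicCompletion E'}
    (hjv : ∀ a, Valued.v (toPlace w.1 w₁ a) ≤ 1 ↔ Valued.v a ≤ 1)
    (hjfix : ∀ z : (w₁.1.adicCompletion E'), galAdicCompletionMap (L := E') c₁ hw₁ z = z ↔ ∃ a, toPlace w.1 w₁ a = z)
    (hΘj : ∀ a, Θ (toPlace w.1 w₁ a) = toPlace w.1 w₁ ((galAdicCompletionMap (L := L) (IsCMField.complexConj L) hw) a))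
    (hΘΘ : ∀ z, Θ (Θ z) = z) (hΘρ : ∀ z, Θ (galAdicCompletionMap (L := E') c₁ hw₁ z) = galAdicCompletionMap (L := E') c₁ hw₁ (Θ z)) (hvΘ : ∀ z, Valued.v (Θ z) = Valued.v z)
    (hα : galAdicCompletionMap (L := E') c₁ hw₁ α ≠ α) (hα1 : Valued.v α ≤ 1)
    (hint : ∀ z : (w₁.1.adicCompletion E'), Valued.v z ≤ 1 → Valued.v ((z - galAdicCompletionMap (L := E') c₁ hw₁ z) / (α - galAdicCompletionMap (L := E') c₁ hw₁ α)) ≤ 1)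
    (hlam2 : lam * lam = toPlace w.1 w₁ (((((localNonsplitEquiv (IsCMField.complexConj L) (Matrix.of fun i j : Fin 2 => if i.val + j.val + 1 = 2 then (1 : L) else 0) (IsCMField.complexConj_ne_one L) w hw) γ₂ : ↥(unitaryGroupOfForm (galAdicCompletionMap (L := L) (IsCMField.complexConj L) hw) (placeForm (Matrix.of fun i j : Fin 2 => if i.val + j.val + 1 = 2 then (1 : L) else 0) w.1))) : GL (Fin 2) (w.1.adicCompletion L)) : Matrix (Fin 2) (Fin 2) (w.1.adicCompletion L))).trace * lam - toPlace w.1 w₁ (((((localNonsplitEquiv (IsCMField.complexConj L) (Matrix.of fun i j : Fin 2 => if i.val + j.val + 1 = 2 then (1 : L) else 0) (IsCMField.complexConj_ne_one L) w hw) γ₂ : ↥(unitaryGroupOfForm (galAdicCompletionMap (L := L) (IsCMField.complexConj L) hw) (placeForm (Matrix.of fun i j : Fin 2 => if i.val + j.val + 1 = 2 then (1 : L) else 0) w.1))) : GL (Fin 2) (w.1.adicCompletion L)) : Matrix (Fin 2) (Fin 2) (w.1.adicCompletion L))).det)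
    (hρlam : galAdicCompletionMap (L := E') c₁ hw₁ lam = toPlace w.1 w₁ (((((localNonsplitEquiv (IsCMField.complexConj L) (Matrix.of fun i j : Fin 2 => if i.val + j.val + 1 = 2 then (1 : L) else 0) (IsCMField.complexConj_ne_one L) w hw) γ₂ : ↥(unitaryGroupOfForm (galAdicCompletionMap (L := L) (IsCMField.complexConj L) hw) (placeForm (Matrix.of fun i j : Fin 2 => if i.val + j.val + 1 = 2 then (1 : L) else 0) w.1))) : GL (Fin 2) (w.1.adicCompletion L)) : Matrix (Fin 2) (Fin 2) (w.1.adicCompletion L))).trace - lam)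
    (hΘlam : Θ lam * lam = 1) (hvlam : Valued.v lam = 1)
    -- TYPE RamM
    (hlt : Valued.v (α - galAdicCompletionMap (L := E') c₁ hw₁ α) < 1)
    -- the (C-0) data on `M`: a `ρ`-datum and a `Θ`-datum (any uniformisers)
    {ϖM ϖΘ : w₁.1.adicCompletion E'} {dρ tρ dΘ tΘ : ℕ} (hDρ : IsRamifiedQuadraticDatum (galAdicCompletionMap (L := E') c₁ hw₁) ϖM dρ tρ) (hDΘ : IsRamifiedQuadraticDatum Θ ϖΘ dΘ tΘ)
    -- the conductor level of `lam` (★ RamMDep spelling)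
    {jl : ℕ} (hjl : Valued.v (lam - galAdicCompletionMap (L := E') c₁ hw₁ lam) = Valued.v (toPlace w.1 w₁ ϖ ^ jl * (ϖM - galAdicCompletionMap (L := E') c₁ hw₁ ϖM)))
    {g : ℕ} (hg : dΘ = 2 * g) :
    jl % 2 = g % 2 ∧
      (Fintype.card (Valued.ResidueField (w.1.adicCompletion L)) - 1) *
          (Nat.card (fixedBy (((cmDatum L 2 (Matrix.of fun i j : Fin 2 => if i.val + j.val + 1 = 2 then (1 : L) else 0)).Local v) ⧸
                cmLocalIntegralLevel L 2 (Matrix.of fun i j : Fin 2 => if i.val + j.val + 1 = 2 then (1 : L) else 0) v) γ₂) + d % 2) + 2 =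
        2 * Fintype.card (Valued.ResidueField (w.1.adicCompletion L)) ^ ((jl - g) / 2 + 1) := by
  obtain ⟨n, hn, hlaw⟩ := hSide_closedForm_ramM L v w hw hϖF he hD γ₂ hirr htube E' c₁ hc₁ w₁ hw₁ Θ hjv hjfix hΘj hΘΘ hΘρ hvΘ hα hα1 hint
    hlam2 hρlam hΘlam hvlam hlt hDρ hDΘ hjl
  refine ⟨by omega, ?_⟩
  rw [show (jl - g) / 2 + 1 = n + 1 by omega]
  exact hlaw

end Place

end Summit.HodgeConjecture.HodgeConjecture.Cruxes.H413.F0P3cDyRamHSideClosedFormRamM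

end
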